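import Summits.CriticalPhenomena.PercolationContinuityZ3.Theorems.SahiAEOpenBand

/-!
# Open bands in every dimension: generic families of base points and the separable correction

Support file of the Sahi cell (`prim-sahi`, typer seat, generation 25; `--supports stmt-CriticalPhenomena-4575`).
One small definition (`PairGenOn`), theorems otherwise; no named facts, no sorries.

Second file of the structure theorem for densities with zeros in every dimension.  Let `U ⊆ ℝ^ι` be an open band
(`IsOpenBand`) and `φ : ℝ^ι → ℝ` measurable, supermodular on almost every pair OF `U`.

* `PairGenOn U φ c c'` — the pair of base points `(c, c')` is generic RELATIVE TO `U`: for every `i` and almost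
  every `(r, t)` with `(c; i := r), (c'; i := t) ∈ U` the supermodular inequality holds at this pair; almost every
  pair is generic (`ae_pairGenOn`, from `ae_pair_update`), and for a generic pair with `c ≤ c'` off `i` the
  difference of the two axis sections `t ↦ φ(c'; i := t) − φ(c; i := t)` is non-decreasing on almost every
  comparable pair of parameters where both lines run in `U` (`ae_monotone_lineDiff`).
* `exists_openBand_seq` — a sequence of base points `c_k ∈ U`, dense in `U`, each generic for every patched
  function `patch φ j` (`GenAt`, generation 24) and with all pairs generic relative to `U`.
* geometry of a dense family in an open band: every point of `U` is a ROBUST height of the family in every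
  direction (`IsOpenBand.exists_robust`: some family line passes through `U` at the heights `zᵢ` and `zᵢ + r_k`),
  and above any two parallel lines running in `U` near a height there is a family line running in `U` near that
  height (`IsOpenBand.exists_line_above`, pure lattice algebra: the join of a nearby point with the join line).

`SahiAEOpenBandLines.lean` builds the separable correction `Σᵢ φ(c_{k(xᵢ)}; i := xᵢ)` read off the family lines;
`SahiAEOpenBandRegularity.lean` and `SahiAEOpenBandVersion.lean` take the lower-corner envelope of
`exp(φ − correction)`.  No sorries, no new axioms.
-/

noncomputable section

namespace Summit.CriticalPhenomena.PercolationContinuityZ3.Theorems.SahiAEFourFunctions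

open MeasureTheory Set Filter Topology Function Metric
open scoped ENNReal NNReal

variable {ι : Type*} [Fintype ι] [DecidableEq ι]

/-! ### Generic pairs of base points relative to `U` -/

omit [Fintype ι] in
/-- **Generic pair of base points relative to `U`**: on the parallel axis lines through `c` and `c'` in every
direction, the supermodular inequality holds at almost every pair of points of `U`. [this work] -/
def PairGenOn (U : Set (ι → ℝ)) (φ : (ι → ℝ) → ℝ) (c c' : ι → ℝ) : Prop :=
  ∀ i, ∀ᵐ rt ∂(volume : Measure ℝ).prod (volume : Measure ℝ),
    update c i rt.1 ∈ U → update c' i rt.2 ∈ U →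
      φ (update c i rt.1) + φ (update c' i rt.2) ≤
        φ (update c i rt.1 ⊓ update c' i rt.2) + φ (update c i rt.1 ⊔ update c' i rt.2)

/-- **Almost every pair of base points is generic relative to `U`.** [this work] -/
theorem ae_pairGenOn {U : Set (ι → ℝ)} {φ : (ι → ℝ) → ℝ}
    (hsmU : ∀ᵐ q ∂(volume : Measure (ι → ℝ)).prod volume,
      q.1 ∈ U → q.2 ∈ U → φ q.1 + φ q.2 ≤ φ (q.1 ⊓ q.2) + φ (q.1 ⊔ q.2)) :
    ∀ᵐ c ∂(volume : Measure (ι → ℝ)), ∀ᵐ c' ∂(volume : Measure (ι → ℝ)), PairGenOn U φ c c' := by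
  filter_upwards [ae_pair_update (P := fun q : (ι → ℝ) × (ι → ℝ) =>
    q.1 ∈ U → q.2 ∈ U → φ q.1 + φ q.2 ≤ φ (q.1 ⊓ q.2) + φ (q.1 ⊔ q.2)) hsmU] with c hc
  filter_upwards [hc] with c' hc' i
  filter_upwards [hc' i] with rt hrt
  exact hrt

omit [Fintype ι] in
/-- Meet of two updated points ordered off the updated coordinate. [folklore] -/
theorem update_inf_update_of_le_off {e c : ι → ℝ} {i : ι} (hle : ∀ j, j ≠ i → e j ≤ c j) {t t' : ℝ}
    (htt' : t ≤ t') : update e i t' ⊓ update c i t = update e i t := by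
  funext j
  by_cases hj : j = i
  · subst hj; simp [htt']
  · simp [hj, hle j hj]

omit [Fintype ι] in
/-- Join of two updated points ordered off the updated coordinate. [folklore] -/
theorem update_sup_update_of_le_off {e c : ι → ℝ} {i : ι} (hle : ∀ j, j ≠ i → e j ≤ c j) {t t' : ℝ}
    (htt' : t ≤ t') : update e i t' ⊔ update c i t = update c i t' := by
  funext j
  by_cases hj : j = i
  · subst hj; simp [htt']
  · simp [hj, hle j hj]

omit [Fintype ι] in
/-- **Increasing differences along parallel lines of a generic pair.**  If `(e, c)` is generic relative to `U` and
`e ≤ c` off the coordinate `i`, the difference `t ↦ φ(c; i := t) − φ(e; i := t)` is non-decreasing on almost every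
comparable pair of heights at which both lines run in `U`. [this work] -/
theorem ae_monotone_lineDiff {U : Set (ι → ℝ)} {φ : (ι → ℝ) → ℝ} {e c : ι → ℝ} (hg : PairGenOn U φ e c) {i : ι}
    (hle : ∀ j, j ≠ i → e j ≤ c j) :
    ∀ᵐ z ∂(volume : Measure ℝ).prod (volume : Measure ℝ), z.1 ≤ z.2 →
      update e i z.1 ∈ U → update c i z.1 ∈ U → update e i z.2 ∈ U → update c i z.2 ∈ U →
        φ (update c i z.1) - φ (update e i z.1) ≤ φ (update c i z.2) - φ (update e i z.2) := by
  have hsw := (Measure.measurePreserving_swap (μ := (volume : Measure ℝ))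
    (ν := (volume : Measure ℝ))).quasiMeasurePreserving.ae (hg i)
  filter_upwards [hsw] with z hz hle' _ hc1 he2 _
  simp only [Prod.fst_swap, Prod.snd_swap] at hz
  have h := hz he2 hc1
  rw [update_inf_update_of_le_off hle hle', update_sup_update_of_le_off hle hle'] at h
  linarith

omit [Fintype ι] in
/-- Generic pairs relative to `U` are symmetric. [folklore] -/
theorem PairGenOn.symm {U : Set (ι → ℝ)} {φ : (ι → ℝ) → ℝ} {c c' : ι → ℝ} (h : PairGenOn U φ c c') :
    PairGenOn U φ c' c := by
  intro i
  have hsw := (Measure.measurePreserving_swap (μ := (volume : Measure ℝ))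
    (ν := (volume : Measure ℝ))).quasiMeasurePreserving.ae (h i)
  filter_upwards [hsw] with rt hrt h1 h2
  simp only [Prod.fst_swap, Prod.snd_swap] at hrt
  have h := hrt h2 h1
  rw [inf_comm, sup_comm] at h
  linarith

/-! ### A dense generic sequence of base points -/

/-- **A dense generic sequence of base points of an open band.**  For a non-empty open `U` and a measurable
`φ` there are `c_k ∈ U`, dense in `U`, each generic for every patched function `patch φ j`, and with every pair
`(c_k, c_l)`, `k ≠ l`, generic relative to `U`. [this work] -/
theorem exists_openBand_seq {U : Set (ι → ℝ)} (hUo : IsOpen U) (hne : U.Nonempty) {φ : (ι → ℝ) → ℝ}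
    (hφ : Measurable φ)
    (hsmU : ∀ᵐ q ∂(volume : Measure (ι → ℝ)).prod volume,
      q.1 ∈ U → q.2 ∈ U → φ q.1 + φ q.2 ≤ φ (q.1 ⊓ q.2) + φ (q.1 ⊔ q.2)) :
    ∃ c : ℕ → ι → ℝ, (∀ k, c k ∈ U) ∧
      (∀ O : Set (ι → ℝ), IsOpen O → O.Nonempty → O ⊆ U → ∃ k, c k ∈ O) ∧
      (∀ k j, GenAt (patch φ j) (c k)) ∧
      (∀ k l, k ≠ l → PairGenOn U φ (c k) (c l)) := by
  classical
  obtain ⟨e, he⟩ := exists_surjective_nat ((ι → ℚ) × (ι → ℚ))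
  set R : ℕ → Set (ι → ℝ) := fun k => Set.pi univ fun i => Ioo (ratLo (e k) i) (ratHi (e k) i) with hR
  set T : ℕ → Set (ι → ℝ) := fun k => if R k ⊆ U ∧ (R k).Nonempty then R k else U with hT
  have hTo : ∀ k, IsOpen (T k) := fun k => by
    simp only [hT]
    split_ifs
    · exact isOpen_set_pi Set.finite_univ fun _ _ => isOpen_Ioo
    · exact hUo
  have hTne : ∀ k, (T k).Nonempty := fun k => by
    simp only [hT]
    split_ifs with h
    · exact h.2
    · exact hne
  have hTU : ∀ k, T k ⊆ U := fun k => by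
    simp only [hT]
    split_ifs with h
    · exact h.1
    · exact Subset.rfl
  -- the co-null set of good base points
  set P : (ι → ℝ) → Prop := fun c => (∀ j, GenAt (patch φ j) c) ∧
    ∀ᵐ c' ∂(volume : Measure (ι → ℝ)), PairGenOn U φ c c' with hP
  have hPae : ∀ᵐ c ∂(volume : Measure (ι → ℝ)), P c := (ae_genAt_patch hφ).and (ae_pairGenOn hsmU)
  -- one step: a good point in `T k`, generic with a finite history of good points
  have step : ∀ (k : ℕ) (l : List (ι → ℝ)), (∀ c' ∈ l, P c') →
      ∃ c, c ∈ T k ∧ P c ∧ ∀ c' ∈ l, PairGenOn U φ c' c := by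
    intro k l hl
    have hl' : ∀ᵐ c ∂(volume : Measure (ι → ℝ)), ∀ c' ∈ l, PairGenOn U φ c' c :=
      (ae_ball_iff l.finite_toSet.countable).2 fun c' hc' => (hl c' hc').2
    obtain ⟨c, hcT, hc⟩ := exists_of_ae_of_isOpen' (hPae.and hl') (hTo k) (hTne k)
    exact ⟨c, hcT, hc.1, hc.2⟩
  choose! nxt hnxt using step
  -- histories
  set hist : ℕ → List (ι → ℝ) := fun k => Nat.rec [] (fun k l => l ++ [nxt k l]) k with hhist
  have hist_zero : hist 0 = [] := rfl
  have hist_succ : ∀ k, hist (k + 1) = hist k ++ [nxt k (hist k)] := fun k => rfl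
  have hist_P : ∀ k, ∀ c' ∈ hist k, P c' := by
    intro k
    induction k with
    | zero => simp [hist_zero]
    | succ k ih =>
      intro c' hc'
      rw [hist_succ, List.mem_append, List.mem_singleton] at hc'
      rcases hc' with h | h
      · exact ih c' h
      · rw [h]; exact (hnxt k (hist k) ih).2.1
  set c : ℕ → ι → ℝ := fun k => nxt k (hist k) with hc
  have hmem_hist : ∀ {m k : ℕ}, m < k → c m ∈ hist k := by
    intro m k hmk
    induction k with
    | zero => exact absurd hmk (Nat.not_lt_zero m)
    | succ k ih =>
      rw [hist_succ, List.mem_append, List.mem_singleton]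
      rcases Nat.lt_succ_iff_lt_or_eq.1 hmk with h | h
      · exact Or.inl (ih h)
      · exact Or.inr (by rw [h])
  have hcP : ∀ k, P (c k) := fun k => (hnxt k (hist k) (hist_P k)).2.1
  have hcT : ∀ k, c k ∈ T k := fun k => (hnxt k (hist k) (hist_P k)).1
  have hpair : ∀ {m k : ℕ}, m < k → PairGenOn U φ (c m) (c k) := fun {m k} hmk =>
    (hnxt k (hist k) (hist_P k)).2.2 (c m) (hmem_hist hmk)
  refine ⟨c, fun k => hTU k (hcT k), fun O hO hOne hOU => ?_, fun n j => (hcP n).1 j, fun m n hmn => ?_⟩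
  · -- density: `O` contains a non-empty rational open box, which is some `R k ⊆ U`
    obtain ⟨x, hx⟩ := hOne
    obtain ⟨j, hlo, hhi, hj⟩ := exists_rat_box_between hO le_rfl (by simpa using hx)
    obtain ⟨k, hk⟩ := he j
    have hRk : R k ⊆ O := fun y hy => hj ⟨fun i => by
      have := (Set.mem_univ_pi.1 hy i).1; rw [hk] at this; exact this.le, fun i => by
      have := (Set.mem_univ_pi.1 hy i).2; rw [hk] at this; exact this.le⟩
    have hRne : (R k).Nonempty := ⟨x, Set.mem_univ_pi.2 fun i => by rw [hk]; exact ⟨hlo i, hhi i⟩⟩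
    have hTk : T k = R k := by simp only [hT, if_pos (And.intro (hRk.trans hOU) hRne)]
    exact ⟨k, hRk (by rw [← hTk]; exact hcT k)⟩
  · rcases Nat.lt_or_gt_of_ne hmn with h | h
    · exact hpair h
    · exact (hpair h).symm

/-! ### Robust heights -/

/-- **Every point of `U` lies at a robust height of the family in every direction**: for `z ∈ U` and a dense
family some line `c_k` passes through `U` at the heights `zᵢ` and `zᵢ + r_k` (members of the family of large index
accumulate at `z`). [this work] -/
theorem IsOpenBand.exists_robust {U : Set (ι → ℝ)} (hU : IsOpenBand U) {c : ℕ → ι → ℝ}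
    (hd : ∀ O : Set (ι → ℝ), IsOpen O → O.Nonempty → O ⊆ U → ∃ k, c k ∈ O) {z : ι → ℝ} (hz : z ∈ U) (i : ι) :
    ∃ k, update (c k) i (z i) ∈ U ∧ update (c k) i (z i + cornerRadius k) ∈ U := by
  obtain ⟨ρ, hρ, hball⟩ := Metric.isOpen_iff.1 hU.isOpen z hz
  obtain ⟨N, hN⟩ := (eventually_cornerRadius_lt (half_pos hρ)).exists_forall_of_atTop
  -- an open subset of `U` avoiding `c 0, …, c N`
  set F : Set (ι → ℝ) := c '' ↑(Finset.range (N + 1)) with hF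
  have hFfin : F.Finite := (Finset.finite_toSet (Finset.range (N + 1))).image c
  have hF0 : volume F = 0 := by
    refine measure_mono_null (fun x hx => ?_)
      ((SahiAESeparableTilt.quasiMeasurePreserving_eval (ι := ι) i).preimage_null
        ((hFfin.image fun x : ι → ℝ => x i).measure_zero volume))
    exact ⟨x, hx, rfl⟩
  set O : Set (ι → ℝ) := Metric.ball z (ρ / 2) \ F with hO
  have hOo : IsOpen O := Metric.isOpen_ball.sdiff hFfin.isClosed
  have hOU : O ⊆ U := fun x hx => hball (Metric.ball_subset_ball (by linarith) hx.1)
  have hOne : O.Nonempty := by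
    refine nonempty_of_measure_ne_zero (μ := (volume : Measure (ι → ℝ))) ?_
    rw [hO, measure_sdiff_null hF0]
    exact (Metric.isOpen_ball.measure_pos volume ⟨z, Metric.mem_ball_self (half_pos hρ)⟩).ne'
  obtain ⟨k, hkO⟩ := hd O hOo hOne hOU
  have hkN : N ≤ k := by
    by_contra hlt
    exact hkO.2 ⟨k, Finset.mem_coe.2 (Finset.mem_range.2 (by omega)), rfl⟩
  have hdist : ∀ (x : ι → ℝ), (∀ j, |x j - z j| < ρ) → x ∈ U := fun x hx =>
    hball (by rw [Metric.mem_ball, dist_pi_lt_iff hρ]; exact fun j => by rw [Real.dist_eq]; exact hx j)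
  have hk : ∀ j, |c k j - z j| < ρ / 2 := fun j => by
    have h1 := hkO.1
    rw [Metric.mem_ball, dist_pi_lt_iff (half_pos hρ)] at h1
    have := h1 j; rwa [Real.dist_eq] at this
  refine ⟨k, hdist _ fun j => ?_, hdist _ fun j => ?_⟩
  · by_cases hj : j = i
    · subst hj; rw [update_self, sub_self, abs_zero]; exact hρ
    · rw [update_of_ne hj]; linarith [hk j]
  · by_cases hj : j = i
    · subst hj; rw [update_self, add_sub_cancel_left, abs_of_pos (cornerRadius_pos k)]
      linarith [hN k hkN]
    · rw [update_of_ne hj]; linarith [hk j]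

/-! ### A family line above two lines -/

/-- **A family line above two lines.**  If the `i`-lines through `a` and `b` lie in `U` at all heights `s` with
`|s − t₀| < ε`, then some member `c_l` of a dense family lies strictly above `a ⊔ b` off the coordinate `i` and its
`i`-line lies in `U` at all heights `s` with `|s − t₀| < ε / 2` (it is the join of a point of `U` near
`(a ⊔ b; i := t₀ − ε/2)` with the line of `a ⊔ b`). [this work] -/
theorem IsOpenBand.exists_line_above {U : Set (ι → ℝ)} (hU : IsOpenBand U) {c : ℕ → ι → ℝ}
    (hd : ∀ O : Set (ι → ℝ), IsOpen O → O.Nonempty → O ⊆ U → ∃ k, c k ∈ O) {a b : ι → ℝ} {i : ι} {t₀ ε : ℝ}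
    (hε : 0 < ε) (ha : ∀ s, |s - t₀| < ε → update a i s ∈ U) (hb : ∀ s, |s - t₀| < ε → update b i s ∈ U) :
    ∃ l, (∀ j, j ≠ i → max (a j) (b j) < c l j) ∧ ∀ s, |s - t₀| < ε / 2 → update (c l) i s ∈ U := by
  set d : ι → ℝ := a ⊔ b with hd'
  have hdline : ∀ s, |s - t₀| < ε → update d i s ∈ U := fun s hs => by
    have e : update d i s = update a i s ⊔ update b i s := by
      funext j; by_cases hj : j = i
      · subst hj; simp
      · simp [hj, hd']
    rw [e]; exact hU.sup_mem _ (ha s hs) _ (hb s hs)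
  set s₁ : ℝ := t₀ - ε / 2 with hs₁
  have hs₁U : update d i s₁ ∈ U := hdline s₁ (by rw [hs₁, abs_lt]; constructor <;> linarith)
  obtain ⟨ρ, hρ, hball⟩ := Metric.isOpen_iff.1 hU.isOpen _ hs₁U
  set O : Set (ι → ℝ) := {z | (∀ j, j ≠ i → d j < z j ∧ z j < d j + ρ) ∧ |z i - s₁| < ρ} with hO
  have hdist : ∀ z : ι → ℝ, (∀ j, |z j - update d i s₁ j| < ρ) → z ∈ U := fun z hz =>
    hball (by rw [Metric.mem_ball, dist_pi_lt_iff hρ]; exact fun j => by rw [Real.dist_eq]; exact hz j)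
  have hOU : O ⊆ U := fun z hz => hdist z fun j => by
    by_cases hj : j = i
    · subst hj; rw [update_self]; exact hz.2
    · rw [update_of_ne hj, abs_lt]; constructor <;> linarith [(hz.1 j hj).1, (hz.1 j hj).2]
  have hOo : IsOpen O := by
    have e : O = (⋂ j, {z : ι → ℝ | j ≠ i → d j < z j ∧ z j < d j + ρ}) ∩ {z | |z i - s₁| < ρ} := by
      ext z; simp only [hO, Set.mem_setOf_eq, Set.mem_inter_iff, Set.mem_iInter]
    rw [e]
    refine (isOpen_iInter_of_finite fun j => ?_).inter ?_
    · by_cases hj : j = i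
      · have : {z : ι → ℝ | j ≠ i → d j < z j ∧ z j < d j + ρ} = univ := by
          ext z; simp [hj]
        rw [this]; exact isOpen_univ
      · have : {z : ι → ℝ | j ≠ i → d j < z j ∧ z j < d j + ρ} = {z | d j < z j ∧ z j < d j + ρ} := by
          ext z; simp [hj]
        rw [this]
        exact (isOpen_lt continuous_const (continuous_apply j)).inter
          (isOpen_lt (continuous_apply j) continuous_const)
    · exact isOpen_lt (continuous_abs.comp ((continuous_apply i).sub continuous_const)) continuous_const
  have hOne : O.Nonempty := by
    refine ⟨update (fun j => d j + ρ / 2) i s₁, fun j hj => ?_, ?_⟩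
    · rw [update_of_ne hj]; constructor <;> linarith
    · rw [update_self, sub_self, abs_zero]; exact hρ
  obtain ⟨l, hl⟩ := hd O hOo hOne hOU
  have hl1 : update (c l) i s₁ ∈ U := hdist _ fun j => by
    by_cases hj : j = i
    · subst hj; rw [update_self, update_self, sub_self, abs_zero]; exact hρ
    · rw [update_of_ne hj, update_of_ne hj, abs_lt]; constructor <;> linarith [(hl.1 j hj).1, (hl.1 j hj).2]
  refine ⟨l, fun j hj => ?_, fun s hs => ?_⟩
  · have := (hl.1 j hj).1; simp only [hd', Pi.sup_apply] at this; exact this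
  · have hs' : s₁ ≤ s := by rw [abs_lt] at hs; linarith
    have e : update (c l) i s = update (c l) i s₁ ⊔ update d i s := by
      funext j; by_cases hj : j = i
      · subst hj; simp [hs']
      · simp [hj, ((hl.1 j hj).1).le]
    rw [e]
    exact hU.sup_mem _ hl1 _ (hdline s (by rw [abs_lt] at hs ⊢; constructor <;> linarith))

end Summit.CriticalPhenomena.PercolationContinuityZ3.Theorems.SahiAEFourFunctions
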